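import Literature.AlgebraicGeometry.Motives.MixedHodgeStructureAdditiveFunctions
import Literature.AlgebraicGeometry.Motives.MixedHodgeStructureLoewyLength
import HarnessLib

/-!
# Additive functions along chains: Loewy layers and composition series (Krause (13.1.2))

Sequel to `MixedHodgeStructureAdditiveFunctions` (`IsAdditive χ`: `χ(H) = χ(R) + χ(H/R)`, `χ(B) = χ(A) + χ(B/A)`
for `A ⊆ B`). Krause, *Homological Theory of Representations*, §13.1, Lemma 13.1.1 / (13.1.2): an additive function
on a length category is `χ = Σ_S χ(S) · χ_S`, `χ_S(X)` the multiplicity of `S` "in a composition series of `X`" —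
i.e. **`χ(X)` is the sum of `χ` over the factors of any composition series, or of any finite chain refining to one**.
For mixed Hodge structures (Cattani–El Zein–Griffiths–Lê, Thm. 3.2.18; Loewy series as in Anderson–Fuller §32) this
file proves the telescoping identities

* §1 along an increasing chain `x₀ ⊆ x₁ ⊆ ⋯` of sub-MHS: `χ(x_n) = χ(x_0) + Σ_{k<n} χ(x_{k+1}/x_k)`; along a
  decreasing chain `y₀ ⊇ y₁ ⊇ ⋯`: `χ(y_0) = χ(y_n) + Σ_{k<n} χ(y_k/y_{k+1})`; `χ(T) = χ(H)` for `T = H`, `χ(0) = 0`.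
* §2 **Loewy layers**: `χ(soc^n H) = Σ_{k<n} χ(soc^{k+1}H / soc^k H)` and **`χ(H) = Σ_{k<ℓℓ(H)} χ(soc^{k+1}H/soc^k H)`**;
  dually `χ(H) = χ(rad^n H) + Σ_{k<n} χ(rad^k H / rad^{k+1} H)` and **`χ(H) = Σ_{k<ℓℓ(H)} χ(rad^k H/rad^{k+1} H)`**.
* §3 **composition series** (Krause (13.1.2) read along a Jordan–Hölder series): for a composition series
  `0 = s₀ ⋖ s₁ ⋖ ⋯ ⋖ s_n = H`, **`χ(H) = Σ_i χ(s_{i+1}/s_i)`** (`IsAdditive.apply_eq_sum_compositionSeries`); hence the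
  dimension and the **Hodge numbers of `H` are the sums of those of its composition factors**
  (`finrank_eq_sum_compositionSeries`, `hodgeNumber_eq_sum_compositionSeries`).

All statements proved; no definitions, no named facts, no instances.

## References

* [Krause2021] H. Krause, Homological Theory of Representations (2021), §13.1, Lemma 13.1.1 and (13.1.2).
* [AndersonFuller1992] F. W. Anderson, K. R. Fuller, Rings and Categories of Modules, 2nd ed. (1992), §32 (Loewy series).
* [Beachy1999RingsModules] J. A. Beachy, Introductory Lectures on Rings and Modules (1999), §2.5, Def. 2.5.1, Thm. 2.5.2.
* [CattaniElZeinGriffithsLe2014] E. Cattani et al. (eds.), Hodge Theory (2014), Thm. 3.2.18, Cor. 3.2.21 (ii).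
-/

noncomputable section

namespace Literature.AlgebraicGeometry.Motives

namespace MixedHodgeStructure

open Module SubMixedHodgeStructure

universe u v

variable {M : Type v} [AddCommMonoid M]
variable {χ : ∀ (U : Type u) [AddCommGroup U] [Module ℚ U] [FiniteDimensional ℚ U], MixedHodgeStructure U → M}
variable {V : Type u} [AddCommGroup V] [Module ℚ V] [FiniteDimensional ℚ V] {H : MixedHodgeStructure V}

namespace IsAdditive

/-! ### §1 Telescoping along chains of sub-MHS -/

/-- `χ(T) = χ(H)` for a sub-MHS with `T = V`. [cite: Krause2021, §13.1 (additive functions)] -/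
theorem apply_of_eq_top (hχ : IsAdditive χ) (T : SubMixedHodgeStructure H) (hT : T.toSubmodule = ⊤) :
    χ _ T.toMixedHodgeStructure = χ V H := by
  refine hχ.iso T.subtype ⟨Submodule.injective_subtype _, ?_⟩
  rw [← LinearMap.range_eq_top]
  exact (Submodule.range_subtype _).trans hT

/-- `χ(T) = 0` for the zero sub-MHS (values in a cancellative monoid). [cite: Krause2021, §13.1 (additive functions)] -/
theorem apply_of_eq_bot {M : Type v} [AddCancelCommMonoid M]
    {χ : ∀ (U : Type u) [AddCommGroup U] [Module ℚ U] [FiniteDimensional ℚ U], MixedHodgeStructure U → M}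
    (hχ : IsAdditive χ) (T : SubMixedHodgeStructure H) (hT : T.toSubmodule = ⊥) : χ _ T.toMixedHodgeStructure = 0 := by
  haveI : Subsingleton T.toSubmodule := by rw [hT]; infer_instance
  exact hχ.apply_of_subsingleton _

/-- **Increasing chains: `χ(x_n) = χ(x_0) + Σ_{k<n} χ(x_{k+1}/x_k)`.** [cite: Krause2021, §13.1, (13.1.2)] -/
theorem apply_chain_eq (hχ : IsAdditive χ) (x : ℕ → SubMixedHodgeStructure H)
    (hx : ∀ k, (x k).toSubmodule ≤ (x (k + 1)).toSubmodule) (n : ℕ) :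
    χ _ (x n).toMixedHodgeStructure =
      χ _ (x 0).toMixedHodgeStructure + ∑ k ∈ Finset.range n, χ _ ((x k).comap (x (k + 1)).subtype).quotient := by
  induction n with
  | zero => rw [Finset.range_zero, Finset.sum_empty, add_zero]
  | succ n ih =>
    rw [Finset.sum_range_succ, ← add_assoc, ← ih]
    exact hχ.apply_eq_add_subquotient (hx n)

/-- **Decreasing chains: `χ(y_0) = χ(y_n) + Σ_{k<n} χ(y_k/y_{k+1})`.** [cite: Krause2021, §13.1, (13.1.2)] -/
theorem apply_antichain_eq (hχ : IsAdditive χ) (y : ℕ → SubMixedHodgeStructure H)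
    (hy : ∀ k, (y (k + 1)).toSubmodule ≤ (y k).toSubmodule) (n : ℕ) :
    χ _ (y 0).toMixedHodgeStructure =
      χ _ (y n).toMixedHodgeStructure + ∑ k ∈ Finset.range n, χ _ ((y (k + 1)).comap (y k).subtype).quotient := by
  induction n with
  | zero => rw [Finset.range_zero, Finset.sum_empty, add_zero]
  | succ n ih =>
    rw [Finset.sum_range_succ, add_comm (∑ k ∈ Finset.range n, _) _, ← add_assoc, ← hχ.apply_eq_add_subquotient (hy n)]
    exact ih

/-! ### §2 Loewy layers -/

/-- **`χ(soc^n H) = Σ_{k<n} χ(soc^{k+1} H / soc^k H)`** (cancellative values). [cite: AndersonFuller1992, §32 (Loewy series)]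
[cite: Krause2021, §13.1, (13.1.2)] -/
theorem apply_socleSeries_eq {M : Type v} [AddCancelCommMonoid M]
    {χ : ∀ (U : Type u) [AddCommGroup U] [Module ℚ U] [FiniteDimensional ℚ U], MixedHodgeStructure U → M}
    (hχ : IsAdditive χ) (H : MixedHodgeStructure V) (n : ℕ) :
    χ _ (socleSeries H n).toMixedHodgeStructure =
      ∑ k ∈ Finset.range n, χ _ ((socleSeries H k).comap (socleSeries H (k + 1)).subtype).quotient := by
  rw [hχ.apply_chain_eq (socleSeries H) (le_socleSeries_succ H) n, socleSeries_zero,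
    hχ.apply_of_eq_bot _ (bot_toSubmodule H), zero_add]

/-- **`χ(H) = Σ_{k<ℓℓ(H)} χ(soc^{k+1} H / soc^k H)`**: an additive invariant is the sum over the Loewy (socle) layers.
[cite: AndersonFuller1992, §32 (Loewy series)] [cite: Krause2021, §13.1, (13.1.2)] -/
theorem apply_eq_sum_socleLayers {M : Type v} [AddCancelCommMonoid M]
    {χ : ∀ (U : Type u) [AddCommGroup U] [Module ℚ U] [FiniteDimensional ℚ U], MixedHodgeStructure U → M}
    (hχ : IsAdditive χ) (H : MixedHodgeStructure V) :
    χ V H = ∑ k ∈ Finset.range (loewyLength H),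
      χ _ ((socleSeries H k).comap (socleSeries H (k + 1)).subtype).quotient := by
  rw [← hχ.apply_socleSeries_eq H, hχ.apply_of_eq_top _ (socleSeries_loewyLength_eq_top H)]

/-- **`χ(H) = χ(rad^n H) + Σ_{k<n} χ(rad^k H / rad^{k+1} H)`.** [cite: AndersonFuller1992, §32 (Loewy series)] [cite: Krause2021, §13.1, (13.1.2)] -/
theorem apply_eq_apply_radicalSeries_add (hχ : IsAdditive χ) (H : MixedHodgeStructure V) (n : ℕ) :
    χ V H = χ _ (radicalSeries H n).toMixedHodgeStructure +
      ∑ k ∈ Finset.range n, χ _ ((radicalSeries H (k + 1)).comap (radicalSeries H k).subtype).quotient := by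
  rw [← hχ.apply_antichain_eq (radicalSeries H) (radicalSeries_succ_le H) n, radicalSeries_zero]
  exact (hχ.apply_of_eq_top _ rfl).symm

/-- **`χ(H) = Σ_{k<ℓℓ(H)} χ(rad^k H / rad^{k+1} H)`**: the sum over the radical layers (cancellative values).
[cite: AndersonFuller1992, §32 (Loewy series)] [cite: Krause2021, §13.1, (13.1.2)] -/
theorem apply_eq_sum_radicalLayers {M : Type v} [AddCancelCommMonoid M]
    {χ : ∀ (U : Type u) [AddCommGroup U] [Module ℚ U] [FiniteDimensional ℚ U], MixedHodgeStructure U → M}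
    (hχ : IsAdditive χ) (H : MixedHodgeStructure V) :
    χ V H = ∑ k ∈ Finset.range (loewyLength H),
      χ _ ((radicalSeries H (k + 1)).comap (radicalSeries H k).subtype).quotient := by
  rw [hχ.apply_eq_apply_radicalSeries_add H (loewyLength H), hχ.apply_of_eq_bot _ radicalSeries_loewyLength_eq_bot,
    zero_add]

/-! ### §3 Composition series -/

/-- **Krause (13.1.2) along a Jordan–Hölder series: `χ(H) = Σ_i χ(s_{i+1}/s_i)`** for every composition series
`0 = s₀ ⋖ s₁ ⋖ ⋯ ⋖ s_n = H` and every additive `χ` with cancellative values.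
[cite: Krause2021, §13.1, Lemma 13.1.1 and (13.1.2)] [cite: Beachy1999RingsModules, §2.5, Def. 2.5.1 and Thm. 2.5.2] -/
theorem apply_eq_sum_compositionSeries {M : Type v} [AddCancelCommMonoid M]
    {χ : ∀ (U : Type u) [AddCommGroup U] [Module ℚ U] [FiniteDimensional ℚ U], MixedHodgeStructure U → M}
    (hχ : IsAdditive χ) (s : H.CompositionSeries) (hb : s.head = (bot H).toElt) (ht : s.last = (top H).toElt) :
    χ V H = ∑ i : Fin s.length, χ _ ((ofElt (s i.castSucc)).comap (ofElt (s i.succ)).subtype).quotient := by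
  -- the chain `x k = s_{min k n}`
  let x : ℕ → SubMixedHodgeStructure H := fun k =>
    ofElt (s ⟨min k s.length, (min_le_right _ _).trans_lt (Nat.lt_succ_self _)⟩)
  have hx_of_le : ∀ {k : ℕ} (hk : k ≤ s.length), x k = ofElt (s ⟨k, Nat.lt_succ_of_le hk⟩) := fun {k} hk =>
    congrArg (fun i => ofElt (s i)) (Fin.ext (min_eq_left hk))
  have hx_of_ge : ∀ {k : ℕ} (hk : s.length ≤ k), x k = ofElt s.last := fun {k} hk =>
    congrArg (fun i => ofElt (s i)) (Fin.ext (by simp [min_eq_right hk, Fin.last]))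
  have hx : ∀ k, (x k).toSubmodule ≤ (x (k + 1)).toSubmodule := fun k => by
    rcases lt_or_ge k s.length with hk | hk
    · rw [hx_of_le hk.le, hx_of_le (Nat.succ_le_of_lt hk)]
      exact (s.covBy_succ ⟨k, hk⟩).le
    · rw [hx_of_ge hk, hx_of_ge (hk.trans (Nat.le_succ k))]
  have h := hχ.apply_chain_eq x hx s.length
  -- the ends: `x n = H`, `x 0 = 0`
  have htop : (x s.length).toSubmodule = ⊤ := by
    rw [hx_of_ge le_rfl, ht, ofElt_toElt, top_toSubmodule]
  have hbot : (x 0).toSubmodule = ⊥ := by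
    rw [hx_of_le (Nat.zero_le _), show (⟨0, Nat.lt_succ_of_le (Nat.zero_le _)⟩ : Fin (s.length + 1)) = 0 from rfl,
      show s 0 = s.head from rfl, hb, ofElt_toElt, bot_toSubmodule]
  rw [hχ.apply_of_eq_top _ htop, hχ.apply_of_eq_bot _ hbot, zero_add, Finset.sum_range] at h
  rw [h]
  refine Finset.sum_congr rfl fun i _ => ?_
  have h1 : x (i : ℕ) = ofElt (s i.castSucc) := (hx_of_le i.2.le).trans (congrArg (fun j => ofElt (s j)) (Fin.ext rfl))
  have h2 : x ((i : ℕ) + 1) = ofElt (s i.succ) := (hx_of_le (Nat.succ_le_of_lt i.2)).trans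
    (congrArg (fun j => ofElt (s j)) (Fin.ext rfl))
  rw [h1, h2]

end IsAdditive

/-- **The dimension of `H` is the sum of the dimensions of its composition factors.** [cite: Krause2021, §13.1, (13.1.2)]
[cite: Beachy1999RingsModules, §2.5, Thm. 2.5.2] -/
theorem finrank_eq_sum_compositionSeries (s : H.CompositionSeries) (hb : s.head = (bot H).toElt) (ht : s.last = (top H).toElt) :
    finrank ℚ V = ∑ i : Fin s.length,
      finrank ℚ (↥(ofElt (s i.succ)).toSubmodule ⧸ ((ofElt (s i.castSucc)).comap (ofElt (s i.succ)).subtype).toSubmodule) :=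
  isAdditive_finrank.apply_eq_sum_compositionSeries (H := H) s hb ht

/-- **The Hodge numbers of `H` are the sums of the Hodge numbers of its composition factors**:
`h^{p,q}(H) = Σ_i h^{p,q}(s_{i+1}/s_i)`. [cite: Krause2021, §13.1, (13.1.2)] [cite: CattaniElZeinGriffithsLe2014, Cor. 3.2.21 (ii)] -/
theorem hodgeNumber_eq_sum_compositionSeries (s : H.CompositionSeries) (hb : s.head = (bot H).toElt)
    (ht : s.last = (top H).toElt) (p q : ℤ) :
    H.hodgeNumber p q = ∑ i : Fin s.length, ((ofElt (s i.castSucc)).comap (ofElt (s i.succ)).subtype).quotient.hodgeNumber p q :=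
  (isAdditive_hodgeNumber p q).apply_eq_sum_compositionSeries s hb ht

/-- The dimension of `H` is the sum of the dimensions of its socle layers. [cite: AndersonFuller1992, §32 (Loewy series)] -/
theorem finrank_eq_sum_socleLayers (H : MixedHodgeStructure V) :
    finrank ℚ V = ∑ k ∈ Finset.range (loewyLength H),
      finrank ℚ (↥(socleSeries H (k + 1)).toSubmodule ⧸ ((socleSeries H k).comap (socleSeries H (k + 1)).subtype).toSubmodule) :=
  isAdditive_finrank.apply_eq_sum_socleLayers H

/-- **The Hodge numbers of `H` are the sums of the Hodge numbers of its Loewy (socle) layers.**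
[cite: AndersonFuller1992, §32 (Loewy series)] [cite: CattaniElZeinGriffithsLe2014, Cor. 3.2.21 (ii)] -/
theorem hodgeNumber_eq_sum_socleLayers (H : MixedHodgeStructure V) (p q : ℤ) :
    H.hodgeNumber p q = ∑ k ∈ Finset.range (loewyLength H),
      ((socleSeries H k).comap (socleSeries H (k + 1)).subtype).quotient.hodgeNumber p q :=
  (isAdditive_hodgeNumber p q).apply_eq_sum_socleLayers H

/-- The multiplicities of `H` are the sums of the multiplicities of its Loewy (socle) layers:
`[H : S] = Σ_{k<ℓℓ(H)} [soc^{k+1}H/soc^k H : S]`. [cite: AndersonFuller1992, §32 (Loewy series)] [cite: Beachy1999RingsModules, §2.5, Thm. 2.5.2] -/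
theorem multiplicity_eq_sum_socleLayers {U₀ : Type*} [AddCommGroup U₀] [Module ℚ U₀] (H : MixedHodgeStructure V)
    (S : MixedHodgeStructure U₀) :
    H.multiplicity S = ∑ k ∈ Finset.range (loewyLength H),
      ((socleSeries H k).comap (socleSeries H (k + 1)).subtype).quotient.multiplicity S :=
  (isAdditive_multiplicity S).apply_eq_sum_socleLayers H

/-- … and of its radical layers: `[H : S] = Σ_{k<ℓℓ(H)} [rad^k H/rad^{k+1} H : S]`. [cite: AndersonFuller1992, §32 (Loewy series)]
[cite: Beachy1999RingsModules, §2.5, Thm. 2.5.2] -/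
theorem multiplicity_eq_sum_radicalLayers {U₀ : Type*} [AddCommGroup U₀] [Module ℚ U₀] (H : MixedHodgeStructure V)
    (S : MixedHodgeStructure U₀) :
    H.multiplicity S = ∑ k ∈ Finset.range (loewyLength H),
      ((radicalSeries H (k + 1)).comap (radicalSeries H k).subtype).quotient.multiplicity S :=
  (isAdditive_multiplicity S).apply_eq_sum_radicalLayers H

end MixedHodgeStructure

end Literature.AlgebraicGeometry.Motives
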